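import Summits.HodgeConjecture.HodgeConjecture.Theses.LinearSystemTorelli
import Literature.AlgebraicGeometry.HodgeTheory.SupportedClassesOfChowZeroRankOne
import Literature.AlgebraicGeometry.HodgeTheory.SupportedClassesHodgeConiveau

/-!
# Route LinearSystemTorelli — `ConiveauOneOfVanishingGenus` in the sector `CH₀(X)_ℚ = ℚ` (stmt-HodgeConjecture-2410)

The support item `ConiveauOneOfVanishingGenus` (stmt-HodgeConjecture-2410: for `p ≥ 1` and `X`
smooth projective of dimension `2p` with `h^{2p,0} = 0`, `N¹ H²ᵖ(X(ℂ); ℂ) = ⊤`) is GHC(2p, 1) for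
the full middle cohomology and open in general (`p ≥ 2`). Its docstring names the sector where it
is known: "cubic/quartic/quintic fourfolds where it is known via decomposition of the diagonal".
This file records that sector against the route's decls, from the Literature theorem
`GysinFormalism.supportedClasses_eq_top_of_chowRankLEOneUpTo_zero` (Bloch–Srinivas 1983 / Voisin,
JOMP 2025, Cor. 5.7 on the tree's carriers: `dim_ℚ CH₀(X)_ℚ ≤ 1 ⟹ N¹ Hᵏ = Hᵏ` for `k ≥ 1`, proved
relative to a Gysin / cycle-class formalism `G : GysinFormalism` — a PARAMETER, the tree's idiom;
no named fact is used, the decomposition of the diagonal and projective Hironaka being proved):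

* `linearSystemTorelli_coniveauOneOfVanishingGenus_sector_chowZero` — the item's conclusion
  `supportedClasses X (2p) 1 = ⊤` for every smooth projective `X` of dimension `2p`, `p ≥ 1`, with
  `Motives.ChowRankLEOneUpTo X 0`, granted `G` (the hypothesis `h^{2p,0} = 0` is not even needed: it
  FOLLOWS, `…_forall_isOfHodgeType_eq_zero_sector_chowZero`, Mumford–Roĭtman through Grothendieck's
  trivial reason, granted `Grothendieck1969_supportedClasses_le_hodgeConiveau`).
* `linearSystemTorelli_transcendentalOrSupported_sector_chowZero` — hence the route's crux
  `TranscendentalOrSupported` (stmt-HodgeConjecture-10853) holds trivially in this sector (every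
  class is supported on a divisor), granted `G`.
* `linearSystemTorelli_middleDivisorSupportFourfold_sector_chowZero` — and so does the fourfold
  battleground `MiddleDivisorSupportFourfold` (stmt-HodgeConjecture-2409) for fourfolds with
  `CH₀(X)_ℚ = ℚ` (cubic, quartic, quintic fourfolds, granted that Chow-theoretic input), granted `G`.

References: S. Bloch, V. Srinivas, Amer. J. Math. 105 (1983), Thm. 1; C. Voisin, J. Open Math.
Probl. 1 (2025), Prop. 5.5, Thm. 5.6, Cor. 5.7; C. Voisin, Hodge Theory and Complex Algebraic
Geometry II (2003), Thm. 10.17, Cor. 10.28.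
-/

-- `Summit.HodgeConjecture.HodgeConjecture.Theorems` is the mandated namespace (single-conjunct summit:
-- Sub = Summit), which `linter.dupNamespace` flags on every declaration; the lakefile turns the
-- linter off tree-wide (weak option), restated here so stand-alone elaboration is warning-free too.
set_option linter.dupNamespace false

noncomputable section

namespace Summit.HodgeConjecture.HodgeConjecture.Theorems

open Literature.AlgebraicGeometry.HodgeTheory Literature.AlgebraicGeometry.Motives
open Literature.AlgebraicTopology.SingularHomology

/-- **The item in the sector `CH₀(X)_ℚ = ℚ`.** For `p ≥ 1` and `X` smooth projective of dimension
`2p` over `ℂ` with `dim_ℚ CH₀(X) ⊗ ℚ ≤ 1` (`Motives.ChowRankLEOneUpTo X 0`), ALL of `H²ᵖ(X(ℂ); ℂ)` is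
supported in codimension `≥ 1`: `supportedClasses X (2p) 1 = ⊤` — the conclusion of
`ConiveauOneOfVanishingGenus`, granted a Gysin / cycle-class formalism `G` (Bloch–Srinivas;
Voisin 2025, Cor. 5.7). [cite: Voisin2025, Cor. 5.7] [cite: BlochSrinivas1983, Thm. 1] -/
theorem linearSystemTorelli_coniveauOneOfVanishingGenus_sector_chowZero (G : GysinFormalism)
    ⦃p : ℕ⦄ ⦃X : SchemeOver ℂ⦄ (hp : 1 ≤ p) (hX : IsSmoothProjective (2 * p) X)
    (hCH : ChowRankLEOneUpTo X 0) : supportedClasses X (2 * p) 1 = ⊤ :=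
  G.supportedClasses_eq_top_of_chowRankLEOneUpTo_zero hX hCH (by omega)

/-- **In that sector the item's hypothesis `h^{k,0} = 0` (`k ≥ 1`) is automatic** (Mumford 1968,
Roĭtman, Bloch–Srinivas; Voisin II, Thm. 10.17 with `k = 0`): every class of type `(k, 0)` is
supported in codimension `≥ 1` (previous theorem) and such classes have Hodge coniveau `≥ 1`
(granted `Grothendieck1969_supportedClasses_le_hodgeConiveau`), so they vanish. Consistency check of
the sector with the item's shape. [cite: VoisinHodgeII2003, Thm. 10.17] [cite: Voisin2025, Thm. 5.2 and Cor. 5.7] -/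
theorem linearSystemTorelli_forall_isOfHodgeType_eq_zero_sector_chowZero (G : GysinFormalism)
    (h : Grothendieck1969_supportedClasses_le_hodgeConiveau) {n : ℕ} {X : SchemeOver ℂ}
    (hX : IsSmoothProjective n X) (hCH : ChowRankLEOneUpTo X 0) {k : ℕ} (hk : 1 ≤ k) :
    ∀ c : complexBetti X k, IsOfHodgeType n X k k 0 c → c = 0 :=
  fun _ hc ↦ h.eq_zero_of_isOfHodgeType_zero hX le_rfl
    ((G.supportedClasses_eq_top_of_chowRankLEOneUpTo_zero hX hCH hk).symm ▸ Submodule.mem_top) hc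

/-- **The crux `TranscendentalOrSupported` (stmt-HodgeConjecture-10853) in the sector
`CH₀(X)_ℚ = ℚ`**: for `p ≥ 1`, `X` smooth projective of dimension `2p` with
`Motives.ChowRankLEOneUpTo X 0`, EVERY family of classes `b : Fin r → H²ᵖ(X(ℂ); ℂ)` is supported on
divisors — no rationality, sub-Hodge or `(2p,0)`-vanishing hypothesis is needed — granted `G`.
[cite: Voisin2025, Cor. 5.7] [cite: BlochSrinivas1983, Thm. 1] -/
theorem linearSystemTorelli_transcendentalOrSupported_sector_chowZero (G : GysinFormalism)
    ⦃p : ℕ⦄ ⦃X : SchemeOver ℂ⦄ (hp : 1 ≤ p) (hX : IsSmoothProjective (2 * p) X)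
    (hCH : ChowRankLEOneUpTo X 0) (r : ℕ) (b : Fin r → complexBetti X (2 * p)) :
    ∀ j, b j ∈ supportedClasses X (2 * p) 1 :=
  fun _ ↦ (linearSystemTorelli_coniveauOneOfVanishingGenus_sector_chowZero G hp hX hCH).symm ▸
    Submodule.mem_top

/-- **The fourfold battleground `MiddleDivisorSupportFourfold` (stmt-HodgeConjecture-2409) in the
sector `CH₀(X)_ℚ = ℚ`**: on a smooth projective complex fourfold with `dim_ℚ CH₀(X) ⊗ ℚ ≤ 1` (e.g.
cubic, quartic and quintic fourfolds, granted that Chow-theoretic input) EVERY class of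
`H⁴(X(ℂ); ℂ)` — in particular every rational `(2,2)`-class — is supported on a divisor, granted `G`
(the item's docstring: "Known: rationally connected / CH₀-small fourfolds (decomposition of the
diagonal: all of H⁴ has coniveau 1: cubics, quartics, quintics in ℙ⁵)").
[cite: Voisin2025, Cor. 5.7] [cite: BlochSrinivas1983, Thm. 1] -/
theorem linearSystemTorelli_middleDivisorSupportFourfold_sector_chowZero (G : GysinFormalism)
    ⦃X : SchemeOver ℂ⦄ (hX : IsSmoothProjective 4 X) (hCH : ChowRankLEOneUpTo X 0)
    (c : complexBetti X 4) : c ∈ supportedClasses X 4 1 :=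
  (G.supportedClasses_eq_top_of_chowRankLEOneUpTo_zero hX hCH (show 1 ≤ 4 by norm_num)).symm ▸
    Submodule.mem_top

end Summit.HodgeConjecture.HodgeConjecture.Theorems

end
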